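/-
Origin: expansion seat `prover-pub-hodgecm-mc-binder-2-g14-0`, handover #N4 2026-08-20T12:17Z md5 f9c34b9b044a (NEW f9c34b9b044a; 186 l.; `sigma34 S := (placePerm (dW S) (dW' S) ·)⁻¹`, `swapPin_eq_torusSwap` (rfl), `placesAt34/pTH34/insAt34/muScalar34`, `omgW_ins₃₄_tprod_famOf_wmInputCM₂g`, `scalar34_eq_of_weight`, **`omgW_ins₃₄_eq_of_weight`** = E's row-19 family `homg₃₄` ∀ f t φ for the census `datumAtσ (sigma34 S)` at the W pin of record, modulo the (J-μ)₃₄ scalar identity read at `swapPin S u_t` (= theta-3's (K14)); imports N3 `OmgInsAll` + #53 `Side34Omg`; NAME LIST: HodgeCM.Model.HypCensus.omgW_ins₃₄_eq_of_weight · HodgeCM.Model.HypCensus.scalar34_eq_of_weight · HodgeCM.Model.HypCensus.omgW_ins₃₄_tprod_famOf_wmInputCM₂g) (`HOME/mc/pub-hodgecm-mc-binder-2/g14/s5b/HodgeCM/Model/HypCensus/OmgInsAll34.lean`, md5 f9c34b9b044a, 186 lines);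
landed by the gen-20 packager (p-g20) in gate run 51 as `HodgeCM/Model/HypCensus/OmgInsAll34.lean` (verbatim).
-/
/-
Copyright (c) 2026. All rights reserved.
Released under Apache 2.0 license as described in the file LICENSE.
-/
import Summits.HodgeConjecture.HodgeCM.Model.HypCensus.OmgInsAll
import Summits.HodgeConjecture.HodgeCM.Model.HypCensus.Side34Omg

/-!
# Census kit (row 19), (T12)/(ORIENTATION-34): the `jT₃₄` torus junction for EVERY printed vector, modulo (J-μ)₃₄

Row 19 lives on the torus `jT₃₄`, whose chart element is `h · diag(swapPin u) · h⁻¹` (#52/#53, `Side34Omg`), `swapPin = torusSwap σ₃₄`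
with the PER-PLACE permutation `σ₃₄ w = (placePerm w)⁻¹` (identity where the sign orders of `(a₀,a₁)` and `(a₂,a₃)` at `w` agree, the
transposition where they disagree).  On letters the (34) Weil scalar is the (12) scalar read at `swapPin u`, so the census for row 19 is the
`σ₃₄`-twisted one, `datumAtσ … σ₃₄` (`PlaceChoice`), and the orientation match `OmgInsLetters.eSigmaAt_torusSwap_archOf` at `σ := σ₃₄`
closes the junction exactly as `OmgInsAll` does for row 18:

* `omgW_ins₃₄_tprod_famOf_wmInputCM₂g` — the Weil side on pure tensors of `locFam` members through `ρ(1,h)` (`cmPairRepTwist_jT₃₄_isoOp`);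
* `scalar34_eq_of_weight` — the two scalars agree under (J-μ)₃₄ (`hμ₃₄`, read at `swapPin u_t` as in #53);
* **`omgW_ins₃₄_eq_of_weight`** — `ω(ι_T t)(ins₃₄ f φ) = ins₃₄ f (ω_T(t) φ)` for every `φ`: E's row-19 family `homg₃₄` for the census
  `datumAtσ σ₃₄`, as a THEOREM modulo (J-μ)₃₄.

KERNEL only; nothing here is a claim of PerL/QW8.
-/

set_option autoImplicit false

noncomputable section

open NumberField NumberField.InfinitePlace
open scoped TensorProduct Classical ComplexConjugate
open MvPolynomial
open Literature.NumberTheory.Automorphic Literature.NumberTheory.Automorphic.UnitaryGroup Literature.NumberTheory.Weil1964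
open Literature.RepresentationTheory.KonnoKonno2007 Literature.RepresentationTheory.KonnoKonno2007.RealDualPair
open Literature.NumberTheory.GelbartRogawski1991 Literature.NumberTheory.GelbartRogawski1991.UnitaryDualPair
open Literature.Analysis.SegalBargmann
open HodgeCM HodgeCM.Model HodgeCM.Adelic
open HodgeCM.PerL34.Fock HodgeCM.PerL34.Fock.PrintDict
open NumberField.SeesawArchTorus

namespace HodgeCM.Model.HypCensus

section Pin

variable {L : CMField} {ι₁ : L →+* ℂ} (V : HermSpace3 L ι₁) (S : StubTree.SeesawDatum L)
variable
  (hGR : (cmSplittingDatum (L : Type) finProdFinEquiv (frameD V) (frameD_real V) (frameD_ne V) (dW S) (dW_real S) (dW_ne S)).CompatibleSplitting)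
  (η : CMAdelic (L : Type) (frameD V) × CMAdelic (L : Type) (dW S) →* ℂˣ)
  (hη : ∀ γU ∈ CMRat (L : Type) (frameD V), ∀ γ ∈ CMRat (L : Type) (dW S), η (γU, γ) = 1)
  (hηc : Continuous fun p => ((η p : ℂˣ) : ℂ))
  (τ : L →+* ℂ) (T : GL (Fin 3) ℂ)
  (hT : formCongr (starRingEnd ℂ) T (V.Hm.map τ) = Literature.Geometry.ComplexHyperbolic.BallModel.J)
variable (hW : (∀ j, 0 < (ι₁ ((dW S) j)).re) ∨ ∀ j, (ι₁ ((dW S) j)).re < 0)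
variable (jD : InfinitePlace (L : Type) → HodgeCM.PerL34.Fock.EqVar → Fin 6) (m₁ m₂ : InfinitePlace (L : Type) → ℤ)

/-- **the (34) twist**: `σ₃₄ w = (placePerm w)⁻¹`, so that `swapPin S = torusSwap σ₃₄` (`rfl`). -/
abbrev sigma34 : InfinitePlace (L : Type) → Equiv.Perm (Fin 2) :=
  fun w => (placePerm (L : Type) (dW S) (ArchSideTerm.dW' S) w).symm

/-- (Ported verbatim from the HodgeCMPerL package; no docstring in the source.) -/
theorem swapPin_eq_torusSwap (u : SeesawArchTorus (L : Type)) : swapPin S u = torusSwap (L : Type) (sigma34 S) u := rfl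

/-- the printed places of the (34) census data (abbreviation). -/
abbrev placesAt34 : FockPlaces :=
  printPlaces (InfinitePlace (L : Type))
    (kindOf (L : Type) (frameD V) (frameD_real V) (dW S) (dW_real S) ι₁ (datumAtσ V S jD (jIOf V S hW) (sigma34 S)))
    (lamOf (L : Type) (frameD V) (frameD_real V) (dW S) (dW_real S) ι₁ (datumAtσ V S jD (jIOf V S hW) (sigma34 S)))
    (lamOf_ne_zero (L : Type) (frameD V) (frameD_real V) (dW S) (dW_real S) ι₁ (datumAtσ V S jD (jIOf V S hW) (sigma34 S)))
    (pinnedVacs (kindOf (L : Type) (frameD V) (frameD_real V) (dW S) (dW_real S) ι₁ (datumAtσ V S jD (jIOf V S hW) (sigma34 S))) m₁ m₂)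

/-- the (34) chart torus hom of the (34) census data (abbreviation). -/
abbrev pTH34 :=
  printedTorusHom (kindOf (L : Type) (frameD V) (frameD_real V) (dW S) (dW_real S) ι₁ (datumAtσ V S jD (jIOf V S hW) (sigma34 S)))
    (lamOf (L : Type) (frameD V) (frameD_real V) (dW S) (dW_real S) ι₁ (datumAtσ V S jD (jIOf V S hW) (sigma34 S)))
    (lamOf_ne_zero (L : Type) (frameD V) (frameD_real V) (dW S) (dW_real S) ι₁ (datumAtσ V S jD (jIOf V S hW) (sigma34 S)))
    (S.jT₃₄.toMonoidHom.comp (toAdeles (L : Type)))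
    (pinnedVacs (kindOf (L : Type) (frameD V) (frameD_real V) (dW S) (dW_real S) ι₁ (datumAtσ V S jD (jIOf V S hW) (sigma34 S))) m₁ m₂)

/-- the (34) insertion of the (34) census data (abbreviation for `Side34Omg.ins₃₄`). -/
abbrev insAt34 (f : FinSB ↥(maximalRealSubfield L) (Fin 6)) :
    (placesAt34 V S hW jD m₁ m₂).F →ₗ[ℂ] CMSchwartz (L : Type) 6 :=
  ins₃₄ V S hGR η (datumAtσ V S jD (jIOf V S hW) (sigma34 S)) m₁ m₂ f

/-- the (J-μ)₃₄ scalar at a printed torus point, read at the swapped point: `η(1,(diag u')_𝔸) · χ_T(u')`, `u' = swapPin u_t`. -/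
abbrev muScalar34 (t : (placesAt34 V S hW jD m₁ m₂).Tg) : ℂ :=
  ((η (archProdHom (↥(maximalRealSubfield L)) (L : Type) (IsCMField.complexConj L) 3 2 (Matrix.diagonal (frameD V))
        (Matrix.diagonal (dW S))
        ((1 : UnitaryGroup.arch (↥(maximalRealSubfield L)) (L : Type) (IsCMField.complexConj L) 3 (Matrix.diagonal (frameD V))),
          archDiag (L : Type) (dW S) (swapPin S (archOf V S (datumAtσ V S jD (jIOf V S hW) (sigma34 S)) m₁ m₂ t)))) : ℂˣ) : ℂ) *
    ((pinTorusChar V S hGR hW (swapPin S (archOf V S (datumAtσ V S jD (jIOf V S hW) (sigma34 S)) m₁ m₂ t)) : Circle) : ℂ)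

set_option maxHeartbeats 400000 in
/-- **the Weil side of the `jT₃₄` torus on a pure tensor of `locFam` members**: through `ρ(1,h)`, the (12)-type scalar at `swapPin u_t`. -/
theorem omgW_ins₃₄_tprod_famOf_wmInputCM₂g
    (i : ∀ b : InfinitePlace (L : Type), locIdx (datumAtσ V S jD (jIOf V S hW) (sigma34 S) b).kind)
    (f : FinSB ↥(maximalRealSubfield L) (Fin 6)) (t : (placesAt34 V S hW jD m₁ m₂).Tg) :
    omgW (wmInputCM₂g V S hGR η hη hηc τ T hT) (pTH34 V S hW jD m₁ m₂ t)
        (insAt34 V S hGR η hW jD m₁ m₂ f (PiTensorProduct.tprod ℂ (famOf V S hW jD m₁ m₂ i))) =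
      (muScalar34 V S hGR η hW jD m₁ m₂ t *
          ∏ w, dLetterAt V S hW jD i w (swapPin S (archOf V S (datumAtσ V S jD (jIOf V S hW) (sigma34 S)) m₁ m₂ t))) •
        insAt34 V S hGR η hW jD m₁ m₂ f (PiTensorProduct.tprod ℂ (famOf V S hW jD m₁ m₂ i)) := by
  dsimp only [omgW, muScalar34, insAt34]
  rw [wmInputCM₂g_ρ_eq_of V S hGR η hη hηc τ T hT hW, printedTorusHom_apply]
  change cmPairRepTwist (L : Type) finProdFinEquiv (frameD V) (frameD_real V) (frameD_ne V) (dW S) (dW_real S) (dW_ne S) hGR η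
      ((1 : CMAdelic (L : Type) (frameD V)),
        (cmAdelicEquiv (L : Type) 2 (Matrix.diagonal (dW S))
          (S.jT₃₄ (toAdeles (L : Type) (archOf V S (datumAtσ V S jD (jIOf V S hW) (sigma34 S)) m₁ m₂ t))) : CMAdelic (L : Type) (dW S))) _ = _
  rw [ins₃₄_apply, cmPairRepTwist_jT₃₄_isoOp, wPair_apply,
    cmPairRepTwist_torus_ins_tprod_of_eigen (L : Type) (frameD V) (frameD_real V) (frameD_ne V) (dW S) (dW_real S) (dW_ne S) hGR ι₁
      (frameD_sign_ι₁' V) hW (frameD_sign_of_ne V)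
      (fun τ' _ => signs_fin_two fun j => re_apply_ne_zero_of_complexConj_eq (L : Type) τ' (dW_real S j) (dW_ne S j)) η
      (datumAtσ V S jD (jIOf V S hW) (sigma34 S)) m₁ m₂ _ f (famOf V S hW jD m₁ m₂ i) (fun w => dLetterAt V S hW jD i w _)
      (fun w => linSubst_torusLetter_placePoly_famOf V S hW jD m₁ m₂ i w _),
    map_smul, ← ins₃₄_apply]

/-- **the two (34) scalars agree under (J-μ)₃₄**: `η · χ_T · ∏_w dLetterAt` at `swapPin u_t` `= ∏_b χ_b(t_b) · polyExcess_b(t_b)`. -/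
theorem scalar34_eq_of_weight (i : ∀ b : InfinitePlace (L : Type), locIdx (datumAtσ V S jD (jIOf V S hW) (sigma34 S) b).kind)
    (t : (placesAt34 V S hW jD m₁ m₂).Tg)
    (hμt : muScalar34 V S hGR η hW jD m₁ m₂ t *
        dIotaAt (L : Type) (frameD V) (dW S) (dW_real S) ι₁ (swapPin S (archOf V S (datumAtσ V S jD (jIOf V S hW) (sigma34 S)) m₁ m₂ t)) =
      (printPlacesW (InfinitePlace (L : Type))
        (kindOf (L : Type) (frameD V) (frameD_real V) (dW S) (dW_real S) ι₁ (datumAtσ V S jD (jIOf V S hW) (sigma34 S)))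
        (lamOf (L : Type) (frameD V) (frameD_real V) (dW S) (dW_real S) ι₁ (datumAtσ V S jD (jIOf V S hW) (sigma34 S)))
        (lamOf_ne_zero (L : Type) (frameD V) (frameD_real V) (dW S) (dW_real S) ι₁ (datumAtσ V S jD (jIOf V S hW) (sigma34 S)))
        (pinnedVacs (kindOf (L : Type) (frameD V) (frameD_real V) (dW S) (dW_real S) ι₁ (datumAtσ V S jD (jIOf V S hW) (sigma34 S))) m₁ m₂)
          t)⁻¹) :
    muScalar34 V S hGR η hW jD m₁ m₂ t *
        ∏ w, dLetterAt V S hW jD i w (swapPin S (archOf V S (datumAtσ V S jD (jIOf V S hW) (sigma34 S)) m₁ m₂ t)) =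
      ∏ b, (((placesAt34 V S hW jD m₁ m₂).loc b).χ (t b) *
        polyExcess (kindOf (L : Type) (frameD V) (frameD_real V) (dW S) (dW_real S) ι₁ (datumAtσ V S jD (jIOf V S hW) (sigma34 S)) b) (i b)
          (kindCoord _ _ _ (kindOf (L : Type) (frameD V) (frameD_real V) (dW S) (dW_real S) ι₁ (datumAtσ V S jD (jIOf V S hW) (sigma34 S)) b)
            (t b))) := by
  have hsplit : ∏ w, dLetterAt V S hW jD i w (swapPin S (archOf V S (datumAtσ V S jD (jIOf V S hW) (sigma34 S)) m₁ m₂ t)) =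
      dIotaAt (L : Type) (frameD V) (dW S) (dW_real S) ι₁ (swapPin S (archOf V S (datumAtσ V S jD (jIOf V S hW) (sigma34 S)) m₁ m₂ t)) *
        ∏ b, eSigmaAt V S hW jD i b (swapPin S (archOf V S (datumAtσ V S jD (jIOf V S hW) (sigma34 S)) m₁ m₂ t)) := by
    unfold dLetterAt
    rw [Finset.prod_mul_distrib, prod_dAt]
    congr 1
    exact Fintype.prod_equiv (cmPlacesEquiv (L : Type)).symm _ _ fun w => rfl
  rw [hsplit, ← mul_assoc, hμt, printPlacesW_apply, inv_inv, printPlaces_χ, Finset.prod_mul_distrib]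
  exact congrArg₂ (· * ·) rfl (Finset.prod_congr rfl fun b _ => by
    rw [swapPin_eq_torusSwap]; exact eSigmaAt_torusSwap_archOf V S hW jD m₁ m₂ i t b)

set_option maxHeartbeats 400000 in
/-- **THE `jT₃₄` TORUS JUNCTION ON EVERY PRINTED VECTOR, from (J-μ)₃₄**: E's row-19 family `homg₃₄` for the (34) census
`datumAtσ σ₃₄`, as a THEOREM modulo the scalar identity `hμ₃₄` (the hypothesis of #53's vacuum junction). -/
theorem omgW_ins₃₄_eq_of_weight
    (hμ : ∀ t : (placesAt34 V S hW jD m₁ m₂).Tg,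
      muScalar34 V S hGR η hW jD m₁ m₂ t *
          dIotaAt (L : Type) (frameD V) (dW S) (dW_real S) ι₁ (swapPin S (archOf V S (datumAtσ V S jD (jIOf V S hW) (sigma34 S)) m₁ m₂ t)) =
        (printPlacesW (InfinitePlace (L : Type))
          (kindOf (L : Type) (frameD V) (frameD_real V) (dW S) (dW_real S) ι₁ (datumAtσ V S jD (jIOf V S hW) (sigma34 S)))
          (lamOf (L : Type) (frameD V) (frameD_real V) (dW S) (dW_real S) ι₁ (datumAtσ V S jD (jIOf V S hW) (sigma34 S)))
          (lamOf_ne_zero (L : Type) (frameD V) (frameD_real V) (dW S) (dW_real S) ι₁ (datumAtσ V S jD (jIOf V S hW) (sigma34 S)))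
          (pinnedVacs (kindOf (L : Type) (frameD V) (frameD_real V) (dW S) (dW_real S) ι₁ (datumAtσ V S jD (jIOf V S hW) (sigma34 S))) m₁ m₂)
            t)⁻¹)
    (f : FinSB ↥(maximalRealSubfield L) (Fin 6)) (t : (placesAt34 V S hW jD m₁ m₂).Tg) (φ : (placesAt34 V S hW jD m₁ m₂).F) :
    omgW (wmInputCM₂g V S hGR η hη hηc τ T hT) (pTH34 V S hW jD m₁ m₂ t) (insAt34 V S hGR η hW jD m₁ m₂ f φ) =
      insAt34 V S hGR η hW jD m₁ m₂ f ((placesAt34 V S hW jD m₁ m₂).ωT t φ) := by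
  have key : ∀ i : (∀ b : InfinitePlace (L : Type), locIdx (datumAtσ V S jD (jIOf V S hW) (sigma34 S) b).kind),
      omgW (wmInputCM₂g V S hGR η hη hηc τ T hT) (pTH34 V S hW jD m₁ m₂ t)
          (insAt34 V S hGR η hW jD m₁ m₂ f (PiTensorProduct.tprod ℂ (famOf V S hW jD m₁ m₂ i))) =
        insAt34 V S hGR η hW jD m₁ m₂ f ((placesAt34 V S hW jD m₁ m₂).ωT t (PiTensorProduct.tprod ℂ (famOf V S hW jD m₁ m₂ i))) := by
    intro i
    rw [omgW_ins₃₄_tprod_famOf_wmInputCM₂g V S hGR η hη hηc τ T hT hW jD m₁ m₂ i f t,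
      scalar34_eq_of_weight V S hGR η hW jD m₁ m₂ i t (hμ t)]
    have hT : (placesAt34 V S hW jD m₁ m₂).ωT t (PiTensorProduct.tprod ℂ (famOf V S hW jD m₁ m₂ i)) =
        (∏ b, (((placesAt34 V S hW jD m₁ m₂).loc b).χ (t b) *
          polyExcess (kindOf (L : Type) (frameD V) (frameD_real V) (dW S) (dW_real S) ι₁ (datumAtσ V S jD (jIOf V S hW) (sigma34 S)) b) (i b)
            (kindCoord _ _ _ (kindOf (L : Type) (frameD V) (frameD_real V) (dW S) (dW_real S) ι₁ (datumAtσ V S jD (jIOf V S hW) (sigma34 S)) b)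
              (t b)))) •
          PiTensorProduct.tprod ℂ (famOf V S hW jD m₁ m₂ i) :=
      ωT_tprod_locFam (InfinitePlace (L : Type)) _ _ _ _ i t
    rw [hT]
    exact ((insAt34 V S hGR η hW jD m₁ m₂ f).map_smul _ _).symm
  have hlin : ((wmInputCM₂g V S hGR η hη hηc τ T hT).ρ (1, (wmInputCM₂g V S hGR η hη hηc τ T hT).eW (pTH34 V S hW jD m₁ m₂ t))).val ∘ₗ
        insAt34 V S hGR η hW jD m₁ m₂ f =
      insAt34 V S hGR η hW jD m₁ m₂ f ∘ₗ (placesAt34 V S hW jD m₁ m₂).ωT t := by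
    refine LinearMap.ext_on (span_tprod_locFam (InfinitePlace (L : Type)) _ _ _ _) ?_
    rintro _ ⟨i, rfl⟩
    exact key i
  exact LinearMap.congr_fun hlin φ

end Pin

end HodgeCM.Model.HypCensus

end
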